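import Literature.NumberTheory.EllipticCurves.UnramifiedCoboundaryInputs
import Literature.NumberTheory.EllipticCurves.FormalGroupKummerPointProofs
import Literature.NumberTheory.EllipticCurves.LocalPointsIntegersSubgroup
import Literature.NumberTheory.EllipticCurves.IwasawaSelmerControlLocalInputsProofs
import Mathlib.Analysis.Normed.Unbundled.SpectralNorm
import HarnessLib

/-!
# Route `ByReductionTypeAtTwo`, item `OrdKatoHalfAtTwo` (stmt-BirchSwinnertonDyer-19271), TOWER road, the
# GOOD-ORDINARY local constant at `v ∣ 2`: KERNEL BRICK G6a — a finite subextension `L ⊆ K̄_v` as a valued field: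
# completeness, the chart lift with descent, and the formal group `E₁(L)` inside `E(K̄_v)`

HONEST FRAMING (cell `bsd-2adic`, run/shared/lean/pub/bsd-2adic/, seat `bsd-2adic-tower-1` GEN 11, HUMAN RULINGS
D-0036 / D-0054 / D-0074): TOOL theorems only (no definition, no named fact, no `sorry`); closes nothing by itself;
nothing booked; BSD is not proved by any of this. Part of the KERNELISATION of the consumed projection `#𝒦_{v,n}[2^∞][2] ≤ 4`
of the PRINT binder `hS34 = Greenberg1999.lemma34_localTowerKerPrimary_cyclicExtension_rat` (Greenberg, LNM 1716, §3 Lemma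
3.4 / Prop. 2.5): the WALL (M4) of the scope memo HOME/tower/SCOPE-hS34-layer-kernel-at-2-GEN7.md §3, «Lutz at the layer»
— `#(E₁(L_n)/p E₁(L_n)) = p^{[L_n:ℚ_p]} · #E₁(L_n)[p]` for the local layer field `L_n = K̄_v^{H_n}` — is obtained by running
the tree's generic engine `FormalGroupDivision` (`kernelLevel`, `relIndex_map_nsmul_kernelLevel_eq`, inputs `hlift`,
`hcomplete`) over the FIELD `L = K̄_v^H` with the restricted spectral valuation `w ∘ (L → K̄_v)`. This file supplies, for
`K = K_v` the completion of a number field, `Ω = K̄_v`, `w` the spectral valuation, `H ≤ Γ_{K_v}` and `L = Ω^H`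
(Mathlib `IntermediateField.fixedField`):

* `exists_limit_of_geometric_fixedField` — `hcomplete`: geometric Cauchy sequences of `L` converge when `[L : K_v] < ∞`
  (Mathlib `spectralNorm.completeSpace`: a finite extension of the complete `K_v` is complete for the spectral norm, which
  is `w` on `L` by `spectralNorm.eq_of_tower`);
* `exists_mem_kernel_zCoord_eq_fixedField` — `hlift`: every `a ∈ L` with `w a < 1` is the parameter `z(P)` of a point
  `P ∈ E₁(L)` of `W ⊗ L` (the tree's `K̄_v`-chart lift WITH Galois descent `UnramifiedCoboundaryInputs.exists_mem_kernel_zCoord_eq`: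
  the Hensel root is unique, hence fixed by `H`, hence has coordinates in `L`);
* `baseChange_fixedField_eq_integer_baseChange` — `W ⊗ L = (W_ℤ ⊗ 𝒪_{w|L}) ⊗ L` for a globally minimal `W/ℚ`
  (integrality of the coefficients, the standing hypothesis of the formal-group files);
* `exists_addEquiv_kernel_fixedField` — **`E₁(L) ≅ E₁(K̄_v)^H`**: the base change `E(L) → E(K̄_v)` (Mathlib
  `WeierstrassCurve.Affine.Point.map`) restricts to an additive isomorphism of the formal group `E₁(L) = kernel (w|L) (W ⊗ L)`
  onto the subgroup of `H`-fixed points of `E₁(K̄_v) = kernel w (W ⊗ K̄_v)`, preserving the level `w(z(·))`.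

References: J. Silverman, *AEC* (2009), VII.2.1–2.2, IV.3.2, IV.6.4; J. Neukirch, *ANT* II (4.8) (uniqueness of the
extended valuation); scope memo §3 (M4).
-/

set_option autoImplicit false
-- the Theorems namespace of this sub repeats the summit name by design (D-0017 nested layout: Summit.<S>.<Sub>)
set_option linter.dupNamespace false

noncomputable section

open scoped Classical NNReal

universe u

namespace Summit.BirchSwinnertonDyer.BirchSwinnertonDyer.Theorems.GoodOrdTower

open NumberField IsDedekindDomain IsDedekindDomain.HeightOneSpectrum Field Literature.NumberTheory.EllipticCurves
  Literature.NumberTheory.EllipticCurves.FormalGroupChart Literature.NumberTheory.GaloisRepresentations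
  WeierstrassCurve Filter Topology

variable {K : Type u} [Field K] [NumberField K] {v : HeightOneSpectrum (𝓞 K)}
  {w : Valuation (AlgebraicClosure (v.adicCompletion K)) ℝ≥0}
  (hw : ∀ x, (w x : ℝ) = spectralNorm (v.adicCompletion K) (AlgebraicClosure (v.adicCompletion K)) x)

/-! ### The restricted spectral valuation of an intermediate field is its spectral norm -/

include hw in
/-- On an intermediate field `L` of `K̄_v/K_v` the spectral valuation of `K̄_v` restricts to the spectral norm of `L/K_v`
(`spectralNorm.eq_of_tower`: both are the spectral value of the minimal polynomial). [cite: NeukirchANT1999, Ch. II Thm. (4.8)] -/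
theorem coe_valuation_comap_fixedField_eq
    (L : IntermediateField (v.adicCompletion K) (AlgebraicClosure (v.adicCompletion K))) (x : L) :
    ((w.comap (algebraMap L (AlgebraicClosure (v.adicCompletion K)))) x : ℝ) =
      spectralNorm (v.adicCompletion K) L x := by
  rw [Valuation.comap_apply, hw, ← spectralNorm.eq_of_tower]

include hw in
/-- **Geometric Cauchy sequences of a finite `L ⊆ K̄_v` converge** (hypothesis `hcomplete` of
`FormalGroupChart.exists_nsmul_eq_of_val_le_mul` for `L`): `L` is complete for its spectral norm (Mathlib
`spectralNorm.completeSpace`, a finite-dimensional normed space over the complete `K_v`), which is `w|_L`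
(`coe_valuation_comap_fixedField_eq`); the error bound is the ultrametric `|x_{k+m} − x_k| ≤ C θᵏ`.
[cite: SilvermanAEC2009, Prop. VII.2.2] -/
theorem exists_limit_of_geometric_fixedField
    (L : IntermediateField (v.adicCompletion K) (AlgebraicClosure (v.adicCompletion K)))
    [FiniteDimensional (v.adicCompletion K) L] (x : ℕ → L) (C θ : ℝ≥0) (hθ : θ < 1)
    (hx : ∀ k, (w.comap (algebraMap L (AlgebraicClosure (v.adicCompletion K)))) (x (k + 1) - x k) ≤ C * θ ^ k) :
    ∃ y : L, ∀ k, (w.comap (algebraMap L (AlgebraicClosure (v.adicCompletion K)))) (y - x k) ≤ C * θ ^ k := by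
  letI hKv : NontriviallyNormedField (v.adicCompletion K) :=
    Valued.toNontriviallyNormedField (v.adicCompletion K) (WithZero (Multiplicative ℤ))
  letI : NormedField L := spectralNorm.normedField (v.adicCompletion K) L
  haveI : CompleteSpace L := spectralNorm.completeSpace (K := v.adicCompletion K) (L := L)
  haveI : IsUltrametricDist L := IsUltrametricDist.isUltrametricDist_of_forall_norm_add_le_max_norm
    (fun a b ↦ isNonarchimedean_spectralNorm (K := v.adicCompletion K) (L := L) a b)
  have hnorm : ∀ z : L, (w.comap (algebraMap L (AlgebraicClosure (v.adicCompletion K)))) z = ‖z‖₊ :=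
    fun z ↦ NNReal.coe_injective (by
      rw [coe_nnnorm]; exact coe_valuation_comap_fixedField_eq hw L z)
  simp only [hnorm] at hx ⊢
  have htail : ∀ k m, ‖x (k + m) - x k‖₊ ≤ C * θ ^ k := by
    intro k m
    induction m with
    | zero => simp
    | succ m ih =>
      have e : x (k + (m + 1)) - x k = (x (k + m + 1) - x (k + m)) + (x (k + m) - x k) := by
        rw [← add_assoc]; abel
      rw [e]
      refine (IsUltrametricDist.nnnorm_add_le_max _ _).trans (max_le ?_ ih)
      calc ‖x (k + m + 1) - x (k + m)‖₊ ≤ C * θ ^ (k + m) := hx (k + m)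
        _ ≤ C * θ ^ k :=
            mul_le_mul' le_rfl (pow_le_pow_right_of_le_one' hθ.le (Nat.le_add_right k m))
  have hcs : CauchySeq x := by
    refine cauchySeq_of_le_geometric (θ : ℝ) C (by exact_mod_cast hθ) fun n ↦ ?_
    rw [dist_eq_norm, ← norm_neg, neg_sub]
    have h := hx n
    rw [← NNReal.coe_le_coe] at h
    push_cast at h
    exact h
  obtain ⟨y, hy⟩ := cauchySeq_tendsto_of_complete hcs
  refine ⟨y, fun k ↦ ?_⟩
  have hlim : Tendsto (fun m ↦ x (k + m)) atTop (𝓝 y) := by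
    have h1 : Tendsto (fun m : ℕ ↦ k + m) atTop atTop := by
      simpa only [add_comm] using tendsto_add_atTop_nat k
    exact hy.comp h1
  have hcont : Continuous fun a : L ↦ ‖a - x k‖₊ := (continuous_id.sub continuous_const).nnnorm
  have h := (hcont.tendsto y).comp hlim
  exact le_of_tendsto' h (fun m ↦ htail k m)

/-! ### The chart lift over `L = K̄_v^H`, with descent -/

include hw in
/-- **`hlift` for the fixed field `L = K̄_v^H`**: for `W/K` with `W ⊗ K̄_v` integral and elliptic, every `a ∈ L` with
`w a < 1` is the parameter of a point of the formal group `E₁(L) = kernel (w|_L) (W ⊗ L)`. The tree's `K̄_v`-lift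
`UnramifiedCoboundaryInputs.exists_mem_kernel_zCoord_eq` produces `P ∈ E₁(K̄_v)` with `z(P) = a`, fixed by every isometric
automorphism fixing `a` — in particular by `H` — so its coordinates lie in `L`. [cite: SilvermanAEC2009, Prop. VII.2.2] -/
theorem exists_mem_kernel_zCoord_eq_fixedField (W : WeierstrassCurve K)
    [hV : (W.baseChange (AlgebraicClosure (v.adicCompletion K))).IsIntegral w.integer]
    [(W.baseChange (AlgebraicClosure (v.adicCompletion K))).IsElliptic]
    (H : Subgroup (absoluteGaloisGroup (v.adicCompletion K)))
    [hVL : (W.baseChange (IntermediateField.fixedField H)).IsIntegral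
      (w.comap (algebraMap (IntermediateField.fixedField H) (AlgebraicClosure (v.adicCompletion K)))).integer]
    {a : IntermediateField.fixedField H}
    (ha : w.comap (algebraMap (IntermediateField.fixedField H) (AlgebraicClosure (v.adicCompletion K))) a < 1) :
    ∃ P ∈ kernel (w.comap (algebraMap (IntermediateField.fixedField H) (AlgebraicClosure (v.adicCompletion K))))
      (W.baseChange (IntermediateField.fixedField H)), P.zCoord = a := by
  -- one `DecidableEq` on the field of definition of the points: the classical one baked into `FormalGroupChart.kernel`
  letI : DecidableEq (IntermediateField.fixedField H) := fun a b ↦ Classical.propDecidable _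
  -- notation
  let Kv := v.adicCompletion K
  let Ω := AlgebraicClosure Kv
  let L : IntermediateField Kv Ω := IntermediateField.fixedField H
  let wL : Valuation L ℝ≥0 := w.comap (algebraMap L Ω)
  have hwL : ∀ x : L, wL x = w (x : Ω) := fun _ ↦ rfl
  -- `(W ⊗ K_v) ⊗ K̄_v = W ⊗ K̄_v`
  have hbb : (W.baseChange Kv).baseChange Ω = W.baseChange Ω :=
    (W.map_baseChange (IsScalarTower.toAlgHom K Kv Ω) : _)
  haveI : ((W.baseChange Kv).baseChange Ω).IsIntegral w.integer := by rw [hbb]; exact hV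
  haveI : ((W.baseChange Kv).baseChange Ω).IsElliptic := by rw [hbb]; infer_instance
  -- the `K̄_v`-lift, fixed by `H`
  have ha' : w ((a : L) : Ω) < 1 := ha
  obtain ⟨P, hPker, hPz, hPfix⟩ := exists_mem_kernel_zCoord_eq (w := w) (W.baseChange Kv) ha'
  have hfixa : ∀ σ ∈ H, (show Ω ≃ₐ[Kv] Ω from σ) ((a : L) : Ω) = ((a : L) : Ω) := fun σ hσ ↦
    (IntermediateField.mem_fixedField_iff H _).mp a.2 σ hσ
  have hPσ : ∀ σ ∈ H, Affine.Point.map ((show Ω ≃ₐ[Kv] Ω from σ) : Ω →ₐ[Kv] Ω) P = P := fun σ hσ ↦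
    hPfix (show Ω ≃ₐ[Kv] Ω from σ) (fun z ↦ spectralValuation_smul hw σ z) (hfixa σ hσ)
  rcases P with _ | ⟨x, y, hxy⟩
  · -- `a = 0`
    refine ⟨0, (kernel wL (W.baseChange L)).zero_mem, ?_⟩
    rw [← WeierstrassCurve.Affine.Point.zero_def, WeierstrassCurve.Affine.Point.zCoord_zero] at hPz
    rw [WeierstrassCurve.Affine.Point.zCoord_zero]
    exact Subtype.ext (by rw [ZeroMemClass.coe_zero]; exact hPz)
  · -- the coordinates are fixed by `H`, hence lie in `L`
    have hxy' : ∀ σ ∈ H, (show Ω ≃ₐ[Kv] Ω from σ) x = x ∧ (show Ω ≃ₐ[Kv] Ω from σ) y = y := by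
      intro σ hσ
      have e := hPσ σ hσ
      rw [Affine.Point.map_some] at e
      injection e with ex ey
      exact ⟨ex, ey⟩
    have hx : x ∈ L := (IntermediateField.mem_fixedField_iff H x).mpr fun σ hσ ↦ (hxy' σ hσ).1
    have hy : y ∈ L := (IntermediateField.mem_fixedField_iff H y).mpr fun σ hσ ↦ (hxy' σ hσ).2
    -- the point over `L`
    have hinj : Function.Injective (IntermediateField.val L) := (algebraMap L Ω).injective
    have hns : (W.baseChange L).toAffine.Nonsingular ⟨x, hx⟩ ⟨y, hy⟩ := by
      rw [← Affine.baseChange_nonsingular (W := W) hinj]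
      rw [hbb] at hxy
      exact hxy
    refine ⟨Affine.Point.some _ _ hns, ?_, ?_⟩
    · rw [some_mem_kernel_iff (w := wL) hns, hwL]
      exact (some_mem_kernel_iff (w := w) hxy).mp hPker
    · apply Subtype.ext
      change (((-(⟨x, hx⟩ : L) / ⟨y, hy⟩ : L)) : Ω) = (a : Ω)
      rw [← hPz]
      push_cast
      rfl

/-! ### `E₁(L) ≅ E₁(K̄_v)^H` -/

/-- **The formal group over the fixed field is the fixed part of the formal group**: for `W/K` with `W ⊗ K̄_v` integral
and elliptic, `H ≤ Γ_{K_v}` and `L = K̄_v^H`, the base change `E(L) → E(K̄_v)` (Mathlib `Affine.Point.map`, injective)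
restricts to an additive isomorphism of `E₁(L) = kernel (w|_L) (W ⊗ L)` onto the subgroup `A_H` of `E(K̄_v)` consisting of the
points of `E₁(K̄_v) = kernel w (W ⊗ K̄_v)` fixed by `H` (a fixed point has its coordinates in `L`), and it preserves the
level `w(z(·))` of the filtration. [cite: SilvermanAEC2009, Prop. VII.2.2] -/
theorem exists_addEquiv_kernel_fixedField (W : WeierstrassCurve K)
    [hV : (W.baseChange (AlgebraicClosure (v.adicCompletion K))).IsIntegral w.integer]
    [(W.baseChange (AlgebraicClosure (v.adicCompletion K))).IsElliptic]
    (H : Subgroup (absoluteGaloisGroup (v.adicCompletion K)))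
    [hVL : (W.baseChange (IntermediateField.fixedField H)).IsIntegral
      (w.comap (algebraMap (IntermediateField.fixedField H) (AlgebraicClosure (v.adicCompletion K)))).integer]
    (AH : AddSubgroup (localPoints W (v.adicCompletion K)))
    (hAH : ∀ Q : localPoints W (v.adicCompletion K), Q ∈ AH ↔
      (Q : (W.baseChange (AlgebraicClosure (v.adicCompletion K))).toAffine.Point) ∈
          kernel w (W.baseChange (AlgebraicClosure (v.adicCompletion K))) ∧
        ∀ σ ∈ H, σ • Q = Q) :
    ∃ e : kernel (w.comap (algebraMap (IntermediateField.fixedField H) (AlgebraicClosure (v.adicCompletion K))))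
        (W.baseChange (IntermediateField.fixedField H)) ≃+ AH,
      ∀ P, w (((e P : AH) : localPoints W (v.adicCompletion K)) :
          (W.baseChange (AlgebraicClosure (v.adicCompletion K))).toAffine.Point).zCoord =
        w.comap (algebraMap (IntermediateField.fixedField H) (AlgebraicClosure (v.adicCompletion K)))
          (P : (W.baseChange (IntermediateField.fixedField H)).toAffine.Point).zCoord := by
  -- one `DecidableEq` on the field of definition of the points: the classical one baked into `FormalGroupChart.kernel`
  letI : DecidableEq (IntermediateField.fixedField H) := fun a b ↦ Classical.propDecidable _
  -- notation
  let Kv := v.adicCompletion K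
  let Ω := AlgebraicClosure Kv
  let L : IntermediateField Kv Ω := IntermediateField.fixedField H
  let wL : Valuation L ℝ≥0 := w.comap (algebraMap L Ω)
  have hwL : ∀ x : L, wL x = w (x : Ω) := fun _ ↦ rfl
  let f : L →ₐ[K] Ω := (IntermediateField.val L).restrictScalars K
  have hf : ∀ x : L, f x = (x : Ω) := fun _ ↦ rfl
  have hfinj : Function.Injective f := (algebraMap L Ω).injective
  let ψ : (W.baseChange L).toAffine.Point →+ (W.baseChange Ω).toAffine.Point := Affine.Point.map f
  have hψinj : Function.Injective ψ := Affine.Point.map_injective (W' := W) f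
  -- `H` fixes the image
  have hfix : ∀ σ ∈ H, ∀ P : (W.baseChange L).toAffine.Point,
      σ • (show localPoints W Kv from ψ P) = (show localPoints W Kv from ψ P) := by
    intro σ hσ P
    have hcomp : ((AlgEquiv.restrictScalars K (show Ω ≃ₐ[Kv] Ω from σ) : Ω ≃ₐ[K] Ω) : Ω →ₐ[K] Ω).comp f = f :=
      AlgHom.ext fun x ↦ (IntermediateField.mem_fixedField_iff H _).mp x.2 σ hσ
    rw [localPoints.smul_def]
    change Affine.Point.map _ (Affine.Point.map f P) = Affine.Point.map f P
    rw [Affine.Point.map_map, hcomp]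
  -- kernel to kernel, and the level
  have hψz : ∀ P : (W.baseChange L).toAffine.Point, (ψ P).zCoord = ((P.zCoord : L) : Ω) := by
    intro P
    rcases P with _ | ⟨x, y, hxy⟩
    · change (Affine.Point.map f 0).zCoord = (((0 : (W.baseChange L).toAffine.Point).zCoord : L) : Ω)
      rw [map_zero, WeierstrassCurve.Affine.Point.zCoord_zero, WeierstrassCurve.Affine.Point.zCoord_zero,
        ZeroMemClass.coe_zero]
    · change (Affine.Point.map f (Affine.Point.some x y hxy)).zCoord = _
      rw [Affine.Point.map_some]
      change -(f x) / f y = (((-x / y : L)) : Ω)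
      rw [hf, hf]
      push_cast
      rfl
  have hψker : ∀ P : (W.baseChange L).toAffine.Point, P ∈ kernel wL (W.baseChange L) ↔
      ψ P ∈ kernel w (W.baseChange Ω) := by
    intro P
    rcases P with _ | ⟨x, y, hxy⟩
    · change (0 : (W.baseChange L).toAffine.Point) ∈ _ ↔ Affine.Point.map f 0 ∈ _
      rw [map_zero]
      exact ⟨fun _ ↦ (kernel w _).zero_mem, fun _ ↦ (kernel wL _).zero_mem⟩
    · change _ ↔ Affine.Point.map f (Affine.Point.some x y hxy) ∈ _
      rw [Affine.Point.map_some, some_mem_kernel_iff (w := wL) hxy, some_mem_kernel_iff (w := w), hf, hwL]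
  -- the restricted map
  have hmem : ∀ P : kernel wL (W.baseChange L), (show localPoints W Kv from ψ P) ∈ AH := fun P ↦
    (hAH _).mpr ⟨(hψker P).mp P.2, fun σ hσ ↦ hfix σ hσ P⟩
  let ψ₁ : kernel wL (W.baseChange L) →+ AH :=
    { toFun := fun P ↦ ⟨_, hmem P⟩
      map_zero' := Subtype.ext (by
        change ψ ((0 : kernel wL (W.baseChange L)) : (W.baseChange L).toAffine.Point) = _
        rw [ZeroMemClass.coe_zero, map_zero]; rfl)
      map_add' := fun P Q ↦ Subtype.ext (by
        change ψ ((P + Q : kernel wL (W.baseChange L)) : (W.baseChange L).toAffine.Point) = _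
        rw [AddSubgroup.coe_add, map_add]; rfl) }
  have hψ₁ : ∀ P : kernel wL (W.baseChange L), ((ψ₁ P : AH) : localPoints W Kv) = ψ P := fun _ ↦ rfl
  have hinj : Function.Injective ψ₁ := by
    intro P Q h
    have h' := congrArg (fun Q : AH ↦ (Q : localPoints W Kv)) h
    simp only [hψ₁] at h'
    exact Subtype.ext (hψinj h')
  have hsurj : Function.Surjective ψ₁ := by
    intro Q
    obtain ⟨hQker, hQfix⟩ := (hAH Q).mp Q.2
    -- the underlying point of `E(K̄_v)`
    rcases hQ : (Q : localPoints W Kv) with _ | ⟨x, y, hxy⟩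
    · refine ⟨0, Subtype.ext ?_⟩
      rw [map_zero, ZeroMemClass.coe_zero, hQ]; rfl
    · -- coordinates fixed by `H`
      have hxy' : ∀ σ ∈ H, (show Ω ≃ₐ[Kv] Ω from σ) x = x ∧ (show Ω ≃ₐ[Kv] Ω from σ) y = y := by
        intro σ hσ
        have e := hQfix σ hσ
        rw [hQ, localPoints.smul_def, Affine.Point.map_some] at e
        injection e with ex ey
        exact ⟨ex, ey⟩
      have hx : x ∈ L := (IntermediateField.mem_fixedField_iff H x).mpr fun σ hσ ↦ (hxy' σ hσ).1
      have hy : y ∈ L := (IntermediateField.mem_fixedField_iff H y).mpr fun σ hσ ↦ (hxy' σ hσ).2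
      have hns : (W.baseChange L).toAffine.Nonsingular ⟨x, hx⟩ ⟨y, hy⟩ := by
        rw [← Affine.baseChange_nonsingular (W := W) hfinj]
        exact hxy
      have hPker : Affine.Point.some _ _ hns ∈ kernel wL (W.baseChange L) := by
        rw [hψker]
        change Affine.Point.map f (Affine.Point.some _ _ hns) ∈ _
        rw [Affine.Point.map_some]
        rw [hQ] at hQker
        exact some_mem_kernel (w := w) _ ((some_mem_kernel_iff (w := w) hxy).mp hQker)
      refine ⟨⟨_, hPker⟩, Subtype.ext ?_⟩
      rw [hψ₁, hQ]
      change Affine.Point.map f (Affine.Point.some _ _ hns) = _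
      rw [Affine.Point.map_some]
      rfl
  refine ⟨AddEquiv.ofBijective ψ₁ ⟨hinj, hsurj⟩, fun P ↦ ?_⟩
  rw [AddEquiv.ofBijective_apply, hψ₁, hψz]
  rfl

/-! ### Transport of the `n`-th power count along an additive isomorphism -/

omit [NumberField K] in
/-- `#(G/nG)` and `#G[n]` are invariant under additive isomorphisms (`n G`, `G[n]` the range and kernel of
`nsmulAddMonoidHom n`). [folklore] -/
theorem natCard_quotient_range_nsmul_congr {G G' : Type*} [AddCommGroup G] [AddCommGroup G'] (e : G ≃+ G') (n : ℕ) :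
    Nat.card (G ⧸ (nsmulAddMonoidHom n : G →+ G).range) = Nat.card (G' ⧸ (nsmulAddMonoidHom n : G' →+ G').range) ∧
    Nat.card (nsmulAddMonoidHom n : G →+ G).ker = Nat.card (nsmulAddMonoidHom n : G' →+ G').ker := by
  constructor
  · refine Nat.card_congr (QuotientAddGroup.congr _ _ e ?_).toEquiv
    ext y
    simp only [AddSubgroup.mem_map, AddMonoidHom.mem_range, nsmulAddMonoidHom_apply, AddMonoidHom.coe_coe]
    constructor
    · rintro ⟨x, ⟨a, rfl⟩, rfl⟩
      exact ⟨e a, (map_nsmul e n a).symm⟩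
    · rintro ⟨a, rfl⟩
      exact ⟨n • e.symm a, ⟨e.symm a, rfl⟩, by rw [map_nsmul, AddEquiv.apply_symm_apply]⟩
  · refine Nat.card_congr ⟨fun x ↦ ⟨e x.1, ?_⟩, fun y ↦ ⟨e.symm y.1, ?_⟩, fun x ↦ ?_, fun y ↦ ?_⟩
    · have hx : n • x.1 = 0 := x.2
      change n • e x.1 = 0
      rw [← map_nsmul, hx, map_zero]
    · have hy : n • y.1 = 0 := y.2
      change n • e.symm y.1 = 0
      rw [← map_nsmul, hy, map_zero]
    · exact Subtype.ext (e.symm_apply_apply x.1)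
    · exact Subtype.ext (e.apply_symm_apply y.1)

end Summit.BirchSwinnertonDyer.BirchSwinnertonDyer.Theorems.GoodOrdTower

end
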